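import Mathlib.LinearAlgebra.FiniteDimensional.Lemmas
import Mathlib.LinearAlgebra.Dimension.Constructions
import Mathlib.Data.Matrix.Mul
import Mathlib.Algebra.Field.ZMod
import Literature.Computability.MetaComplexity.AffineClauseSystems

/-!
# PneNP / ReslinSizeFromWidth — quadratic size–width law, part 1b: equations and flats

Helper file for the quadratic truncation of crux `ResLinSizeFromWidth` (stmt-PneNP-18932).
The space `W S` of affine equations `⟨g, z⟩ = b` (pairs `(g, b) : Eqn V`) satisfied by every point
of a set `S ⊆ 𝔽₂^V`; FLATS (sets cut out by their own equations — the falsifying sets of linear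
clauses); the section of a flat by a hyperplane `hyp θ`, with `W (S ∩ hyp θ) = W S + ⟨θ⟩` for a
nonempty section (via the constancy lemma `AffSys.mem_spanS_of_constant`), whence a proper
nonempty section raises `dim W` by exactly one.  For a nonempty flat, `dim W S` is its codimension.
-/

namespace Summit.PneNP.PneNP.Theorems

-- `Summit.PneNP.PneNP` repeats a path component by design (summit = sub-problem); silence the linter.
set_option linter.dupNamespace false

namespace ResLinSW
-- BEGIN BODY

open Module Submodule

variable {V : Type*} [Fintype V]

/-- The space of affine EQUATIONS over `𝔽₂^V`: a pair `θ = (g, b)` stands for `⟨g, z⟩ = b`;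
`(0, 1)` is the inconsistent equation `0 = 1`. -/
abbrev Eqn (V : Type*) : Type _ := (V → ZMod 2) × ZMod 2

/-- The hyperplane (or `univ`, or `∅`) of solutions of one equation. -/
def hyp (θ : Eqn V) : Set (V → ZMod 2) := {z | θ.1 ⬝ᵥ z = θ.2}

/-- The inconsistent equation `0 = 1`. -/
def one : Eqn V := ((0 : V → ZMod 2), (1 : ZMod 2))

/-- **`W S`**: the equations satisfied by every point of `S` — a subspace of `Eqn V`. For a
nonempty flat `S` its dimension is the codimension of `S`. -/
def W (S : Set (V → ZMod 2)) : Submodule (ZMod 2) (Eqn V) where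
  carrier := {θ | ∀ z ∈ S, θ.1 ⬝ᵥ z = θ.2}
  add_mem' := by
    intro θ η hθ hη z hz
    simp only [Prod.fst_add, Prod.snd_add, add_dotProduct, hθ z hz, hη z hz]
  zero_mem' := by
    intro z _
    simp
  smul_mem' := by
    intro c θ hθ z hz
    simp only [Prod.smul_fst, Prod.smul_snd, smul_eq_mul, smul_dotProduct, hθ z hz]

/-- Membership in `hyp θ`. -/
@[simp] theorem mem_hyp {θ : Eqn V} {z : V → ZMod 2} : z ∈ hyp θ ↔ θ.1 ⬝ᵥ z = θ.2 := Iff.rfl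

/-- Membership in `W S`. -/
theorem mem_W {S : Set (V → ZMod 2)} {θ : Eqn V} : θ ∈ W S ↔ ∀ z ∈ S, θ.1 ⬝ᵥ z = θ.2 :=
  Iff.rfl

/-- `θ ∈ W S` iff `S ⊆ hyp θ`. -/
theorem mem_W_iff_subset_hyp {S : Set (V → ZMod 2)} {θ : Eqn V} : θ ∈ W S ↔ S ⊆ hyp θ :=
  Iff.rfl

/-- `W` is antitone. -/
theorem W_anti {S T : Set (V → ZMod 2)} (h : S ⊆ T) : W T ≤ W S :=
  fun _ hθ z hz => hθ z (h hz)

/-- The equation of a hyperplane is satisfied on it. -/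
theorem self_mem_W_hyp (θ : Eqn V) : θ ∈ W (hyp θ) := fun _ hz => hz

/-- `0 = 1` is satisfied by every point of `S` iff `S` is empty. -/
theorem one_mem_W_iff {S : Set (V → ZMod 2)} : one ∈ W S ↔ S = ∅ := by
  constructor
  · intro h
    rw [Set.eq_empty_iff_forall_notMem]
    intro z hz
    have h1 : (0 : V → ZMod 2) ⬝ᵥ z = 1 := h z hz
    rw [zero_dotProduct] at h1
    exact zero_ne_one h1
  · rintro rfl
    intro z hz
    exact absurd hz (Set.notMem_empty z)

/-- In `𝔽₂`, `a ≠ b` iff `a = b + 1`. -/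
theorem zmod2_ne_iff {a b : ZMod 2} : a ≠ b ↔ a = b + 1 := by
  revert a b; decide

/-- The complementary hyperplane: `hyp (θ + one) = (hyp θ)ᶜ`. -/
theorem mem_hyp_add_one_iff {θ : Eqn V} {z : V → ZMod 2} : z ∈ hyp (θ + one) ↔ z ∉ hyp θ := by
  simp only [mem_hyp, one, Prod.fst_add, Prod.snd_add, add_zero]
  rw [← zmod2_ne_iff]

/-- `hyp 0 = univ`. -/
@[simp] theorem hyp_zero : hyp (0 : Eqn V) = Set.univ := by
  ext z; simp [hyp]

/-- `hyp one = ∅`. -/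
@[simp] theorem hyp_one : hyp (one : Eqn V) = ∅ := by
  ext z; simp [hyp, one]

omit [Fintype V] in
/-- `v + v = 0` in characteristic two (vectors). -/
theorem add_self_eq_zero (v : V → ZMod 2) : v + v = 0 := by
  have zmod2_eq_zero_or_one : ∀ a : ZMod 2, a = 0 ∨ a = 1 := by decide
  funext i
  simp only [Pi.add_apply, Pi.zero_apply]
  rcases zmod2_eq_zero_or_one (v i) with h | h <;> rw [h] <;> decide

/-- A FLAT: a set cut out by its own equations (an affine subspace of `𝔽₂^V`, or `∅`). -/
structure IsFlat (S : Set (V → ZMod 2)) : Prop where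
  /-- a point satisfying every equation of `S` lies in `S` -/
  mem_of : ∀ z, (∀ θ ∈ W S, z ∈ hyp θ) → z ∈ S

/-- `univ` is a flat. -/
theorem isFlat_univ : IsFlat (Set.univ : Set (V → ZMod 2)) := ⟨fun _ _ => Set.mem_univ _⟩

/-- `∅` is a flat. -/
theorem isFlat_empty : IsFlat (∅ : Set (V → ZMod 2)) := by
  refine ⟨fun z hz => ?_⟩
  have h := hz one (one_mem_W_iff.2 rfl)
  simp at h

/-- A hyperplane is a flat. -/
theorem isFlat_hyp (θ : Eqn V) : IsFlat (hyp θ) := ⟨fun _ hz => hz θ (self_mem_W_hyp θ)⟩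

/-- Flats are closed under intersection. -/
theorem IsFlat.inter {S T : Set (V → ZMod 2)} (hS : IsFlat S) (hT : IsFlat T) :
    IsFlat (S ∩ T) := ⟨fun z hz =>
  ⟨hS.mem_of z fun θ hθ => hz θ (W_anti Set.inter_subset_left hθ),
    hT.mem_of z fun θ hθ => hz θ (W_anti Set.inter_subset_right hθ)⟩⟩

/-- The solution set of an affine system is a flat. -/
theorem isFlat_Sol (Ψ : Literature.Computability.MetaComplexity.AffSys V) :
    IsFlat (Literature.Computability.MetaComplexity.AffSys.Sol Ψ) := by
  refine ⟨fun z hz => ?_⟩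
  rw [Literature.Computability.MetaComplexity.AffSys.mem_Sol]
  intro p hp
  exact hz p (fun w hw => (Literature.Computability.MetaComplexity.AffSys.mem_Sol.1 hw) p hp)

/-- Flats are closed under ternary sums (`𝔽₂`-affine combinations). -/
theorem IsFlat.add_add_mem {S : Set (V → ZMod 2)} (hS : IsFlat S) {a b c : V → ZMod 2}
    (ha : a ∈ S) (hb : b ∈ S) (hc : c ∈ S) : a + b + c ∈ S := by
  have zmod2_eq_zero_or_one : ∀ a : ZMod 2, a = 0 ∨ a = 1 := by decide
  refine hS.mem_of _ fun θ hθ => ?_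
  simp only [mem_hyp, dotProduct_add, hθ a ha, hθ b hb, hθ c hc]
  rcases zmod2_eq_zero_or_one θ.2 with h | h <;> rw [h] <;> decide

/-- A flat is the solution set of the (finite) system of all its equations. -/
theorem IsFlat.eq_Sol {S : Set (V → ZMod 2)} (hS : IsFlat S) :
    S = Literature.Computability.MetaComplexity.AffSys.Sol
      ((W S : Set (Eqn V)).toFinite.toFinset) := by
  ext z
  rw [Literature.Computability.MetaComplexity.AffSys.mem_Sol]
  constructor
  · intro hz p hp
    exact mem_W.1 ((Set.Finite.mem_toFinset _).1 hp) z hz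
  · intro h
    exact hS.mem_of z fun θ hθ => h θ ((Set.Finite.mem_toFinset _).2 hθ)

/-! ### Dimension facts -/

/-- For a NONEMPTY set, an equation in `W S` is determined by its linear part. -/
theorem W_eq_of_fst_eq {S : Set (V → ZMod 2)} (hne : S.Nonempty) {θ η : Eqn V} (hθ : θ ∈ W S)
    (hη : η ∈ W S) (h : θ.1 = η.1) : θ = η := by
  obtain ⟨z, hz⟩ := hne
  have h1 := hθ z hz
  have h2 := hη z hz
  rw [h] at h1
  exact Prod.ext h (h1.symm.trans h2)

/-- **Section by a hyperplane.** For a flat `S` with nonempty section `S ∩ hyp θ`, the equations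
of the section are spanned by those of `S` and `θ`. (Constancy lemma / double annihilator.) -/
theorem W_inter_hyp {S : Set (V → ZMod 2)} (hS : IsFlat S) (θ : Eqn V)
    (hne : (S ∩ hyp θ).Nonempty) : W (S ∩ hyp θ) = W S ⊔ (ZMod 2) ∙ θ := by
  classical
  apply le_antisymm
  · intro η hη
    -- the system Ψ = (all equations of S) + θ has solution set S ∩ hyp θ
    set Ψ : Literature.Computability.MetaComplexity.AffSys V :=
      insert θ ((W S : Set (Eqn V)).toFinite.toFinset) with hΨ
    have hSol : Literature.Computability.MetaComplexity.AffSys.Sol Ψ = S ∩ hyp θ := by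
      ext z
      rw [hΨ, Literature.Computability.MetaComplexity.AffSys.mem_Sol]
      constructor
      · intro h
        refine ⟨hS.mem_of z fun θ' hθ' => h θ' (Finset.mem_insert_of_mem
          ((Set.Finite.mem_toFinset _).2 hθ')), h θ (Finset.mem_insert_self _ _)⟩
      · rintro ⟨hzS, hzθ⟩ p hp
        rcases Finset.mem_insert.1 hp with rfl | hp
        · exact hzθ
        · exact mem_W.1 ((Set.Finite.mem_toFinset _).1 hp) z hzS
    obtain ⟨z₀, hz₀⟩ := hne
    have hz₀' : z₀ ∈ Literature.Computability.MetaComplexity.AffSys.Sol Ψ := by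
      rw [hSol]; exact hz₀
    -- η.1 is constant on Sol Ψ, hence lies in the form span of Ψ
    have hconst : ∀ z ∈ Literature.Computability.MetaComplexity.AffSys.Sol Ψ,
        η.1 ⬝ᵥ z = η.1 ⬝ᵥ z₀ := by
      intro z hz
      rw [hSol] at hz
      rw [hη z hz, hη z₀ hz₀]
    have hspan := Literature.Computability.MetaComplexity.AffSys.mem_spanS_of_constant hz₀' hconst
    -- the form span of Ψ is contained in the image of W S ⊔ ⟨θ⟩ under the first projection
    have hforms : (Literature.Computability.MetaComplexity.AffSys.forms Ψ : Set (V → ZMod 2)) ⊆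
        (Submodule.map (LinearMap.fst (ZMod 2) (V → ZMod 2) (ZMod 2)) (W S ⊔ (ZMod 2) ∙ θ) :
          Set (V → ZMod 2)) := by
      intro g hg
      rw [Literature.Computability.MetaComplexity.AffSys.forms, Finset.coe_image] at hg
      obtain ⟨p, hp, rfl⟩ := hg
      rw [hΨ, Finset.coe_insert, Set.mem_insert_iff] at hp
      refine ⟨p, ?_, rfl⟩
      rcases hp with rfl | hp
      · exact Submodule.mem_sup_right (Submodule.mem_span_singleton_self _)
      · exact Submodule.mem_sup_left ((Set.Finite.mem_toFinset _).1 hp)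
    have hspan' : η.1 ∈ Submodule.map (LinearMap.fst (ZMod 2) (V → ZMod 2) (ZMod 2))
        (W S ⊔ (ZMod 2) ∙ θ) := by
      have := Submodule.span_mono (R := ZMod 2) hforms
      rw [Submodule.span_eq] at this
      exact this hspan
    obtain ⟨η', hη', hfst⟩ := Submodule.mem_map.1 hspan'
    -- η' and η agree on the nonempty section, hence are equal
    have hη'W : η' ∈ W (S ∩ hyp θ) := by
      have hle : W S ⊔ (ZMod 2) ∙ θ ≤ W (S ∩ hyp θ) :=
        sup_le (W_anti Set.inter_subset_left)
          ((Submodule.span_singleton_le_iff_mem _ _).2 (W_anti Set.inter_subset_right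
            (self_mem_W_hyp θ)))
      exact hle hη'
    have heq : η = η' := W_eq_of_fst_eq ⟨z₀, hz₀⟩ hη hη'W (by simpa using hfst.symm)
    rw [heq]
    exact hη'
  · exact sup_le (W_anti Set.inter_subset_left)
      ((Submodule.span_singleton_le_iff_mem _ _).2
        (W_anti Set.inter_subset_right (self_mem_W_hyp θ)))

/-- The section by a hyperplane raises `dim W` by at most one. -/
theorem finrank_W_inter_hyp_le {S : Set (V → ZMod 2)} (hS : IsFlat S) (θ : Eqn V)
    (hne : (S ∩ hyp θ).Nonempty) :
    finrank (ZMod 2) ↥(W (S ∩ hyp θ)) ≤ finrank (ZMod 2) ↥(W S) + 1 := by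
  classical
  rw [W_inter_hyp hS θ hne]
  refine (Submodule.finrank_add_le_finrank_add_finrank _ _).trans ?_
  have : finrank (ZMod 2) ↥((ZMod 2) ∙ θ) ≤ 1 := by
    by_cases h : θ = 0
    · rw [h, Submodule.span_zero_singleton, finrank_bot]
      exact zero_le_one
    · rw [finrank_span_singleton h]
  omega

/-- A PROPER nonempty section raises `dim W` by exactly one. -/
theorem finrank_W_inter_hyp_eq {S : Set (V → ZMod 2)} (hS : IsFlat S) (θ : Eqn V)
    (hne : (S ∩ hyp θ).Nonempty) (hnot : θ ∉ W S) :
    finrank (ZMod 2) ↥(W (S ∩ hyp θ)) = finrank (ZMod 2) ↥(W S) + 1 := by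
  have zmod2_eq_zero_or_one : ∀ a : ZMod 2, a = 0 ∨ a = 1 := by decide
  classical
  rw [W_inter_hyp hS θ hne]
  have hθ : θ ≠ 0 := by
    rintro rfl
    exact hnot (Submodule.zero_mem _)
  have hdisj : W S ⊓ (ZMod 2) ∙ θ = ⊥ := by
    rw [eq_bot_iff]
    intro η hη
    rw [Submodule.mem_inf] at hη
    obtain ⟨c, rfl⟩ := Submodule.mem_span_singleton.1 hη.2
    rcases zmod2_eq_zero_or_one c with rfl | rfl
    · simp
    · rw [one_smul] at hη
      exact absurd hη.1 hnot
  have h := Submodule.finrank_sup_add_finrank_inf_eq (W S) ((ZMod 2) ∙ θ)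
  rw [hdisj, finrank_bot, finrank_span_singleton hθ] at h
  omega


-- END BODY
end ResLinSW

end Summit.PneNP.PneNP.Theorems
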